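import Mathlib

/-!
# Young-TPP triples are two-colour separated (tool for stub C of line `schur-weyl-colour-cells`)

Crux `LevelGradedCohnUmans.GradedDesignFamily` (stmt-MatrixMultiplication-7610), line
`schur-weyl-colour-cells`.  The open stub C asks for `2`-colour-separated triples `X, Y, Z ⊆ 𝔖ₙ` of
volume within `n^{-a}` of the wall.  The cheapest certificate of `2`-colour separation is ONE
colouring incidence per target (`colourSeparated_of_incidence` in the skeleton); when the test subset
is allowed to depend on the target only through `z₀` on the domain side and `x₀` on the image side,
the certificate is EQUIVALENT to a purely group-theoretic condition, the **Young-TPP** for the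
stabiliser `H = Stab(L)` of a subset `L ⊆ [n]`:

  `x₀ x⁻¹ y y'⁻¹ z z₀⁻¹ ∈ Stab(L)  ⟹  x = x₀ ∧ y = y' ∧ z = z₀`      (all `x₀,x ∈ X`, `y,y' ∈ Y`, `z,z₀ ∈ Z`).

This file proves: Young-TPP ⟹ the separation clause of `GradedDesignFamily` at
`J = J_2(n) = span{[c' ∘ g = c]}` verbatim (the separator of the target `(x₀, z₀)` is the single test
`[g (z₀⁻¹ L) = x₀⁻¹ L]`, i.e. the colourings `c = 1_L ∘ z₀`, `c' = 1_L ∘ x₀`).  So every Young-TPP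
family of volume `≥ (4^n/n^{3/2})^{3/2} n^{-a}` discharges stub C, and the lead's kit searches
(`htpp_search.py`) explore exactly this architecture.
-/

noncomputable section

set_option linter.dupNamespace false

open scoped BigOperators

namespace Summit.MatrixMultiplication.MatrixMultiplication.Theorems.GradedDesignFamily

/-- The `L`-membership colouring attached to a permutation `u`: `i ↦ [u i ∈ L]` (as `Fin 2`). -/
theorem youngTPP_colouring_comp_eq_iff {n : ℕ} (L : Finset (Fin n)) (u v g : Equiv.Perm (Fin n)) :
    ((fun j : Fin n => if u j ∈ L then (1 : Fin 2) else 0) ∘ ⇑g =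
        fun i : Fin n => if v i ∈ L then (1 : Fin 2) else 0) ↔
      ∀ i : Fin n, (u (g i) ∈ L ↔ v i ∈ L) := by
  constructor
  · intro h i
    have := congrFun h i
    simp only [Function.comp_apply] at this
    by_cases h1 : u (g i) ∈ L <;> by_cases h2 : v i ∈ L <;> simp_all
  · intro h
    funext i
    simp only [Function.comp_apply]
    by_cases h1 : u (g i) ∈ L
    · rw [if_pos h1, if_pos ((h i).1 h1)]
    · rw [if_neg h1, if_neg (fun h2 => h1 ((h i).2 h2))]

/-- `∀ i, (u (g i) ∈ L ↔ v i ∈ L)` says exactly that `u g v⁻¹` stabilises `L` (as a finset image). -/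
theorem youngTPP_forall_iff_image_eq {n : ℕ} (L : Finset (Fin n)) (u v g : Equiv.Perm (Fin n)) :
    (∀ i : Fin n, (u (g i) ∈ L ↔ v i ∈ L)) ↔ Finset.image (⇑(u * g * v⁻¹)) L = L := by
  constructor
  · intro h
    apply Finset.eq_of_subset_of_card_le
    · intro j hj
      obtain ⟨i, hi, rfl⟩ := Finset.mem_image.1 hj
      have := (h (v⁻¹ i)).2 (by simpa using hi)
      simpa [Equiv.Perm.mul_apply] using this
    · rw [Finset.card_image_of_injective _ (u * g * v⁻¹).injective]
  · intro h i
    constructor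
    · intro hi
      -- `v i = (u g v⁻¹)⁻¹ (u (g i))`, and the inverse of a stabiliser stabilises
      have hmem : u (g i) ∈ Finset.image (⇑(u * g * v⁻¹)) L := by rw [h]; exact hi
      obtain ⟨j, hj, hji⟩ := Finset.mem_image.1 hmem
      have : j = v i := by
        have := congrArg (⇑(u * g * v⁻¹)⁻¹) hji
        simpa [Equiv.Perm.mul_apply] using this
      rw [← this]; exact hj
    · intro hi
      have : (u * g * v⁻¹) (v i) ∈ Finset.image (⇑(u * g * v⁻¹)) L := Finset.mem_image_of_mem _ hi
      rw [h] at this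
      simpa [Equiv.Perm.mul_apply] using this

/-- **Young-TPP triples are `2`-colour separated.**  If `x₀ x⁻¹ y y'⁻¹ z z₀⁻¹` stabilises `L` only
in the diagonal case `x = x₀ ∧ y = y' ∧ z = z₀`, then every target `(x₀, z₀)` is separated from
the other quadruple products by the single colouring-incidence test `[1_L ∘ x₀ ∘ g = 1_L ∘ z₀]`,
which lies in the two-colour cell `J_2(n) = span{[c' ∘ g = c]}`; the conclusion is the separation
clause of `GradedDesignFamily` at `J = J_2(n)` verbatim. [folklore] -/
theorem youngTPP_twoColourSeparated {n : ℕ} (L : Finset (Fin n))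
    (X Y Z : Finset (Equiv.Perm (Fin n)))
    (h : ∀ x₀ ∈ X, ∀ x ∈ X, ∀ y ∈ Y, ∀ y' ∈ Y, ∀ z ∈ Z, ∀ z₀ ∈ Z,
      Finset.image (⇑(x₀ * x⁻¹ * y * y'⁻¹ * z * z₀⁻¹)) L = L → x = x₀ ∧ y = y' ∧ z = z₀) :
    ∀ x₀ ∈ X, ∀ z₀ ∈ Z, ∃ f ∈ Submodule.span ℂ {f : Equiv.Perm (Fin n) → ℂ |
        ∃ c c' : Fin n → Fin 2, f = fun g : Equiv.Perm (Fin n) => if c' ∘ (⇑g) = c then (1 : ℂ) else 0},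
      ∀ x ∈ X, ∀ y ∈ Y, ∀ y' ∈ Y, ∀ z ∈ Z,
        (x = x₀ ∧ y = y' ∧ z = z₀ → f (x⁻¹ * y * y'⁻¹ * z) = 1) ∧
        (¬ (x = x₀ ∧ y = y' ∧ z = z₀) → f (x⁻¹ * y * y'⁻¹ * z) = 0) := by
  intro x₀ hx₀ z₀ hz₀
  set c : Fin n → Fin 2 := fun i => if z₀ i ∈ L then 1 else 0 with hc
  set c' : Fin n → Fin 2 := fun j => if x₀ j ∈ L then 1 else 0 with hc'
  refine ⟨fun g => if c' ∘ (⇑g) = c then (1 : ℂ) else 0, Submodule.subset_span ⟨c, c', rfl⟩, ?_⟩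
  intro x hx y hy y' hy' z hz
  have key : ∀ g : Equiv.Perm (Fin n),
      (c' ∘ (⇑g) = c) ↔ Finset.image (⇑(x₀ * g * z₀⁻¹)) L = L := fun g =>
    (youngTPP_colouring_comp_eq_iff L x₀ z₀ g).trans (youngTPP_forall_iff_image_eq L x₀ z₀ g)
  refine ⟨?_, fun hne => ?_⟩
  · rintro ⟨rfl, rfl, rfl⟩
    have e1 : x⁻¹ * y * y⁻¹ * z = x⁻¹ * z := by group
    have e2 : x * (x⁻¹ * z) * z⁻¹ = 1 := by group
    show (if c' ∘ (⇑(x⁻¹ * y * y⁻¹ * z)) = c then (1 : ℂ) else 0) = 1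
    rw [if_pos]
    rw [key, e1, e2]
    simp
  · show (if c' ∘ (⇑(x⁻¹ * y * y'⁻¹ * z)) = c then (1 : ℂ) else 0) = 0
    rw [if_neg]
    intro hcol
    rw [key] at hcol
    have e3 : x₀ * (x⁻¹ * y * y'⁻¹ * z) * z₀⁻¹ = x₀ * x⁻¹ * y * y'⁻¹ * z * z₀⁻¹ := by group
    rw [e3] at hcol
    obtain ⟨rfl, rfl, rfl⟩ := h x₀ hx₀ x hx y hy y' hy' z hz z₀ hz₀ hcol
    exact hne ⟨rfl, rfl, rfl⟩

end Summit.MatrixMultiplication.MatrixMultiplication.Theorems.GradedDesignFamily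

end
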